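import Summits.AnomalousDissipation.AnomalousDissipation.Theorems.SteadyWeakLimitStandingCascadeExistsEnergy
import Summits.AnomalousDissipation.AnomalousDissipation.Theorems.TaylorCertificatesForcedStandingFlowsSubsolution
import Summits.AnomalousDissipation.AnomalousDissipation.Theses.SteadyWeakLimit
import Literature.Analysis.FluidPDE.StationaryEulerLaminatesHighDim
import Literature.Analysis.FunctionSpaces.PeriodicLogCostDeriv
import HarnessLib

/-!
# Route SteadyWeakLimit — `StandingCascadeExists` (item stmt-AnomalousDissipation-1309)

A bounded weak STATIONARY Euler flow on `T³` driven by a smooth steady force and absorbing positive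
power: there are a smooth divergence-free mean-zero `f` and `v ∈ L^∞(T³; ℝ³)`, weakly divergence
free, with `∫ (⟪v, (v·∇)w⟫ + ⟪f, w⟫) = 0` for every smooth divergence-free `w` and `∫ ⟪f, v⟫ > 0`
(`standingCascadeExists_proof`, closing the route decl
`Summit.AnomalousDissipation.AnomalousDissipation.Theses.SteadyWeakLimit.StandingCascadeExists`).

Proof: the FORCED stationary `h`-principle, i.e. the explicit convex-integration iteration of the
tree's proof of Choffrut–Székelyhidi 2014, Thm. 1 (`Literature.Analysis.FluidPDE.StationaryEuler.*`)
run in the AFFINE space of strict subsolutions of `div v = 0`, `div u + ∇q = f`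
(`StandingCascade.FIterData`, files `SteadyWeakLimitStandingCascadeExists{Iteration,Energy}`),
started at the smooth affine subsolution `w_f = (f, ℛf)` of
`TaylorCertificatesForcedStandingFlowsSubsolution.lean` (`ℛ` the De Lellis–Székelyhidi
antidivergence), strict for a large constant energy level `E` (`HighDim.U E = int 𝒦_E^{co}`,
`d = 3`), with the extra test field `(f, 0)` keeping the power within `θ = ½ ∫ |f|²` of its initial
value `∫ ⟪f, f⟫ > 0`. The force is the Kolmogorov-type shear force `f(x) = sin(2π x₁) e₀`.

Generic part (any `FIterData`; the second half of the tree's `StationaryEulerLimit.lean` in the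
affine setting): linear observables of the states pass to the limit by dominated convergence, so
the limit has the SAME weak velocity and stress identities as the base field `w₀`
(`wlim_weak_div`, `wlim_weak_str` — the increments are homogeneous weak subsolutions) and its
pairing with the extra test field stays within `θ` of the initial one (`le_integral_inner_wlim_t`);
hence the limit velocity is bounded, its pairing with gradients and its quadratic weak form are
those of the base field (`integral_inner_vel_wlim_gradient`, `integral_inner_vel_wlim_convect`).

## References

* A. Choffrut, L. Székelyhidi Jr., *Weak solutions to the stationary incompressible Euler
  equations*, SIAM J. Math. Anal. 46 (2014) 4060–4074 = arXiv:1401.4301, Thm. 1, §2.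
* C. De Lellis, L. Székelyhidi Jr., Arch. Ration. Mech. Anal. 195 (2010), Lemma 3, §4.
-/

noncomputable section

open scoped InnerProductSpace ContDiff ENNReal Topology
open Set Function MeasureTheory Metric Filter
open Literature.Analysis.FunctionSpaces Literature.Analysis.FluidPDE
open Literature.Analysis.FluidPDE.StationaryEuler

namespace Summit.AnomalousDissipation.AnomalousDissipation.Theorems

-- the mandated namespace `Summit.<Summit>.<Problem>.Theorems` repeats `AnomalousDissipation` (single-problem summit)
set_option linter.dupNamespace false

namespace StandingCascade

namespace FIterData

variable {d : Type*} [Fintype d] [DecidableEq d] [Nonempty d] (D : FIterData d)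

/-! ## The weak identities pass to the limit -/

/-- **Dominated convergence for linear observables of the states**:
`∫ Σᵢ (w_{φ(j)})_{cᵢ} aᵢ → ∫ Σᵢ w_{cᵢ} aᵢ` for continuous coefficients `aᵢ`. [folklore] -/
theorem tendsto_integral_sum_coord_mul {ι : Type*} [Fintype ι] (c : ι → Idx d) (a : ι → UnitAddTorus d → ℝ)
    (ha : ∀ i, Continuous (a i)) :
    Tendsto (fun j => ∫ x, ∑ i, D.state (D.sub j) x (c i) * a i x) atTop
      (𝓝 (∫ x, ∑ i, D.wlim x (c i) * a i x)) := by
  choose B hB0 hB using fun i => IterData.exists_abs_bound_of_continuous (ha i)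
  have hcoord : ∀ (s : State d) (k : Idx d), |s k| ≤ ‖s‖ := fun s k => by
    simpa using PiLp.norm_apply_le s k
  refine tendsto_integral_of_dominated_convergence (fun _ => ∑ i, D.R * B i) (fun j => ?_) (integrable_const _)
    (fun j => Eventually.of_forall fun x => ?_) ?_
  · exact (continuous_finsetSum _ fun i _ => (((PiLp.continuous_apply 2 (fun _ : Idx d => ℝ) (c i)).comp
      (D.state_continuous _)).mul (ha i))).aestronglyMeasurable
  · rw [Real.norm_eq_abs]
    refine (Finset.abs_sum_le_sum_abs _ _).trans (Finset.sum_le_sum fun i _ => ?_)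
    rw [abs_mul]
    exact mul_le_mul ((hcoord _ _).trans (D.norm_state_le _ x)) (hB i x) (abs_nonneg _) D.R_nonneg
  · filter_upwards [D.ae_tendsto_wlim] with x hx
    exact tendsto_finsetSum _ fun i _ =>
      ((((PiLp.continuous_apply 2 (fun _ : Idx d => ℝ) (c i)).tendsto _).comp hx).mul tendsto_const_nhds)


/-! ## The affine identities pass to the limit -/

/-- **The affine velocity identity along the run**: `∫ Σᵢ (v_k)ᵢ ∂ᵢθ = ∫ Σᵢ (v₀)ᵢ ∂ᵢθ` (the
increments are weak subsolutions of the homogeneous system). [cite: ChoffrutSzekelyhidi2014, Lemma 2] -/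
theorem integral_vel_state (k : ℕ) {θ : UnitAddTorus d → ℝ} (hθ : Torus.IsSmooth θ) :
    ∫ x, ∑ i, vel (D.state k x) i * Torus.partialDeriv i θ x = ∫ x, ∑ i, vel (D.w₀ x) i * Torus.partialDeriv i θ x := by
  have h := (D.state_memX k).sub.1 θ hθ
  have hA : Integrable fun x => ∑ i, vel (D.state k x) i * Torus.partialDeriv i θ x :=
    (isSmooth_finsetSum _ fun i _ => isSmooth_mul' (isSmooth_vel_apply (D.state_memX k).smooth i) (hθ.partialDeriv i)).integrable
  have hB : Integrable fun x => ∑ i, vel (D.w₀ x) i * Torus.partialDeriv i θ x :=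
    (isSmooth_finsetSum _ fun i _ => isSmooth_mul' (isSmooth_vel_apply D.hw₀ i) (hθ.partialDeriv i)).integrable
  have hsplit : (fun x => ∑ i, vel (D.state k x - D.w₀ x) i * Torus.partialDeriv i θ x) =
      fun x => (∑ i, vel (D.state k x) i * Torus.partialDeriv i θ x) - ∑ i, vel (D.w₀ x) i * Torus.partialDeriv i θ x := by
    funext x
    rw [← Finset.sum_sub_distrib]
    exact Finset.sum_congr rfl fun i _ => by rw [vel_sub, PiLp.sub_apply]; ring
  rw [hsplit, integral_sub hA hB] at h
  linarith

/-- **The affine stress identity along the run**: `∫ Σᵢⱼ (u_k)ᵢⱼ ∂ⱼΦᵢ = ∫ Σᵢⱼ (u₀)ᵢⱼ ∂ⱼΦᵢ` for smooth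
divergence-free `Φ`. [cite: ChoffrutSzekelyhidi2014, Lemma 2] -/
theorem integral_str_state (k : ℕ) {Φ : UnitAddTorus d → Ed d} (hΦ : Torus.IsSmooth Φ) (hdiv : Torus.IsDivFree Φ) :
    ∫ x, ∑ i, ∑ j, str (D.state k x) i j * Torus.partialDeriv j (fun y => Φ y i) x =
      ∫ x, ∑ i, ∑ j, str (D.w₀ x) i j * Torus.partialDeriv j (fun y => Φ y i) x := by
  have h := (D.state_memX k).sub.2 Φ hΦ hdiv
  have hA : Integrable fun x => ∑ i, ∑ j, str (D.state k x) i j * Torus.partialDeriv j (fun y => Φ y i) x :=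
    (isSmooth_finsetSum _ fun i _ => isSmooth_finsetSum _ fun j _ =>
      isSmooth_mul' (isSmooth_str_apply (D.state_memX k).smooth i j) ((hΦ.apply i).partialDeriv j)).integrable
  have hB : Integrable fun x => ∑ i, ∑ j, str (D.w₀ x) i j * Torus.partialDeriv j (fun y => Φ y i) x :=
    (isSmooth_finsetSum _ fun i _ => isSmooth_finsetSum _ fun j _ =>
      isSmooth_mul' (isSmooth_str_apply D.hw₀ i j) ((hΦ.apply i).partialDeriv j)).integrable
  have hsplit : (fun x => ∑ i, ∑ j, str (D.state k x - D.w₀ x) i j * Torus.partialDeriv j (fun y => Φ y i) x) =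
      fun x => (∑ i, ∑ j, str (D.state k x) i j * Torus.partialDeriv j (fun y => Φ y i) x) -
        ∑ i, ∑ j, str (D.w₀ x) i j * Torus.partialDeriv j (fun y => Φ y i) x := by
    funext x
    rw [← Finset.sum_sub_distrib]
    refine Finset.sum_congr rfl fun i _ => ?_
    rw [← Finset.sum_sub_distrib]
    exact Finset.sum_congr rfl fun j _ => by rw [str_sub, Matrix.sub_apply]; ring
  rw [hsplit, integral_sub hA hB] at h
  linarith

/-- **The weak velocity identity of the limit is that of the base field**:
`∫ Σᵢ vᵢ ∂ᵢθ = ∫ Σᵢ (v₀)ᵢ ∂ᵢθ`. [cite: ChoffrutSzekelyhidi2014, Lemma 2] -/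
theorem wlim_weak_div {θ : UnitAddTorus d → ℝ} (hθ : Torus.IsSmooth θ) :
    ∫ x, ∑ i, vel (D.wlim x) i * Torus.partialDeriv i θ x = ∫ x, ∑ i, vel (D.w₀ x) i * Torus.partialDeriv i θ x := by
  have h := D.tendsto_integral_sum_coord_mul (fun i : d => Sum.inl i) (fun i => Torus.partialDeriv i θ)
    fun i => (hθ.partialDeriv i).continuous
  have h0 : ∀ j, ∫ x, ∑ i, D.state (D.sub j) x (Sum.inl i) * Torus.partialDeriv i θ x =
      ∫ x, ∑ i, vel (D.w₀ x) i * Torus.partialDeriv i θ x := fun j => by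
    simpa only [vel_apply] using D.integral_vel_state (D.sub j) hθ
  simp only [h0] at h
  simpa only [vel_apply] using (tendsto_nhds_unique h tendsto_const_nhds)

/-- **The weak stress identity of the limit is that of the base field** (tested with smooth
divergence-free fields): `∫ Σᵢⱼ uᵢⱼ ∂ⱼΦᵢ = ∫ Σᵢⱼ (u₀)ᵢⱼ ∂ⱼΦᵢ`. [cite: ChoffrutSzekelyhidi2014, Lemma 2] -/
theorem wlim_weak_str {Φ : UnitAddTorus d → Ed d} (hΦ : Torus.IsSmooth Φ) (hdiv : Torus.IsDivFree Φ) :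
    ∫ x, ∑ i, ∑ j, str (D.wlim x) i j * Torus.partialDeriv j (fun y => Φ y i) x =
      ∫ x, ∑ i, ∑ j, str (D.w₀ x) i j * Torus.partialDeriv j (fun y => Φ y i) x := by
  have h := D.tendsto_integral_sum_coord_mul (fun ij : d × d => Sum.inr ij)
    (fun ij => Torus.partialDeriv ij.2 (fun y => Φ y ij.1)) fun ij => ((hΦ.apply ij.1).partialDeriv ij.2).continuous
  have h0 : ∀ k, ∫ x, ∑ ij : d × d, D.state (D.sub k) x (Sum.inr ij) * Torus.partialDeriv ij.2 (fun y => Φ y ij.1) x =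
      ∫ x, ∑ i, ∑ j, str (D.w₀ x) i j * Torus.partialDeriv j (fun y => Φ y i) x := by
    intro k
    have := D.integral_str_state (D.sub k) hΦ hdiv
    simpa only [str_apply, Fintype.sum_prod_type] using this
  simp only [h0] at h
  have hl := tendsto_nhds_unique h tendsto_const_nhds
  simpa only [str_apply, Fintype.sum_prod_type] using hl

/-! ## The pairing with the test field `t` -/

/-- Pairing a state with `t x` is a linear observable of its coordinates. [folklore] -/
theorem sum_coord_mul_t (w : State d) (x : UnitAddTorus d) : ∑ c, w c * D.t x c = ⟪w, D.t x⟫_ℝ := by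
  simp only [PiLp.inner_apply, RCLike.inner_apply, conj_trivial]
  exact Finset.sum_congr rfl fun c _ => mul_comm _ _

/-- **The states stay `θ`-close to the base field against `t`**:
`∫ ⟪w_k, t⟫ ≥ ∫ ⟪w₀, t⟫ - Σ_{i<k} ε_i`. [folklore] -/
theorem integral_inner_state_t_ge (k : ℕ) :
    (∫ x, ⟪D.w₀ x, D.t x⟫_ℝ) - ∑ i ∈ Finset.range k, D.eps i ≤ ∫ x, ⟪D.state k x, D.t x⟫_ℝ := by
  induction k with
  | zero => simp [D.state_zero]
  | succ k ih =>
    rw [Finset.sum_range_succ]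
    have h1 : Integrable fun x => ⟪D.state k x, D.t x⟫_ℝ := ((D.state_continuous k).inner D.ht).integrable_unitAddTorus
    have h2 : Integrable fun x => ⟪D.incr k x, D.t x⟫_ℝ := ((D.incr_continuous k).inner D.ht).integrable_unitAddTorus
    have hsplit : ∫ x, ⟪D.state (k + 1) x, D.t x⟫_ℝ = (∫ x, ⟪D.state k x, D.t x⟫_ℝ) + ∫ x, ⟪D.incr k x, D.t x⟫_ℝ := by
      rw [← integral_add h1 h2]
      refine integral_congr_ae (Eventually.of_forall fun x => ?_)
      simp only [D.state_succ_apply, inner_add_left]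
    have h3 := D.incr_orth_t k
    rw [hsplit]
    linarith [neg_abs_le (∫ x, ⟪D.incr k x, D.t x⟫_ℝ)]

/-- **The limit stays `θ`-close to the base field against `t`**: `∫ ⟪w, t⟫ ≥ ∫ ⟪w₀, t⟫ - θ`
(dominated convergence along the subsequence and `Σ ε_i ≤ θ`). [folklore] -/
theorem le_integral_inner_wlim_t : (∫ x, ⟪D.w₀ x, D.t x⟫_ℝ) - D.θ ≤ ∫ x, ⟪D.wlim x, D.t x⟫_ℝ := by
  have h := D.tendsto_integral_sum_coord_mul (fun c : Idx d => c) (fun c x => D.t x c)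
    fun c => (PiLp.continuous_apply 2 (fun _ : Idx d => ℝ) c).comp D.ht
  have hfun : (fun j => ∫ x, ∑ c, D.state (D.sub j) x c * D.t x c) = fun j => ∫ x, ⟪D.state (D.sub j) x, D.t x⟫_ℝ := by
    funext j
    exact integral_congr_ae (Eventually.of_forall fun x => D.sum_coord_mul_t _ x)
  have hlim : (∫ x, ∑ c, D.wlim x c * D.t x c) = ∫ x, ⟪D.wlim x, D.t x⟫_ℝ :=
    integral_congr_ae (Eventually.of_forall fun x => D.sum_coord_mul_t _ x)
  rw [hfun, hlim] at h
  refine ge_of_tendsto h (Eventually.of_forall fun j => ?_)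
  have h1 := D.integral_inner_state_t_ge (D.sub j)
  have h2 := D.sum_eps_le (Finset.range (D.sub j))
  linarith

/-! ## Integrability of linear observables of the limit -/

/-- Coordinates of the limit against continuous functions are integrable. [folklore] -/
theorem integrable_wlim_coord_mul (c : Idx d) {a : UnitAddTorus d → ℝ} (ha : Continuous a) :
    Integrable (fun x => D.wlim x c * a x) volume := by
  obtain ⟨B, hB0, hB⟩ := IterData.exists_abs_bound_of_continuous ha
  have hcoord : ∀ (s : State d) (k : Idx d), |s k| ≤ ‖s‖ := fun s k => by
    simpa using PiLp.norm_apply_le s k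
  refine Integrable.mono' (integrable_const (D.R * B)) ?_ ?_
  · exact (((PiLp.continuous_apply 2 (fun _ : Idx d => ℝ) c).comp_aestronglyMeasurable
      D.aestronglyMeasurable_wlim).mul ha.aestronglyMeasurable)
  · filter_upwards [D.ae_norm_wlim_le] with x hx
    rw [Real.norm_eq_abs, abs_mul]
    exact mul_le_mul ((hcoord _ _).trans hx) (hB x) (abs_nonneg _) D.R_nonneg

/-! ## The limit velocity of a forced run -/

/-- **The limit velocity is bounded** (`MemLp ⊤`). [cite: ChoffrutSzekelyhidi2014, Thm. 1] -/
theorem memLp_vel_wlim : MemLp (fun x => vel (D.wlim x)) ∞ volume := by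
  refine memLp_top_of_bound (continuous_vel.comp_aestronglyMeasurable D.aestronglyMeasurable_wlim) D.R ?_
  filter_upwards [D.ae_norm_wlim_le] with x hx using (norm_vel_le _).trans hx

/-- **Pairing of the limit velocity with gradients** is that of the base velocity:
`∫ ⟪v, ∇θ⟫ = ∫ Σᵢ (v₀)ᵢ ∂ᵢθ`. [cite: ChoffrutSzekelyhidi2014, Lemma 2] -/
theorem integral_inner_vel_wlim_gradient {θ : UnitAddTorus d → ℝ} (hθ : Torus.IsSmooth θ) :
    ∫ x, ⟪vel (D.wlim x), Torus.gradient θ x⟫_ℝ = ∫ x, ∑ i, vel (D.w₀ x) i * Torus.partialDeriv i θ x := by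
  have h1 : ∀ x, ⟪vel (D.wlim x), Torus.gradient θ x⟫_ℝ = ∑ i, vel (D.wlim x) i * Torus.partialDeriv i θ x := fun x => by
    rw [real_inner_comm, Torus.inner_gradient_left, Torus.fderiv_apply_eq_sum_partialDeriv (hθ.isContDiff (by simp))]
    simp only [smul_eq_mul]
  simp_rw [h1]
  exact D.wlim_weak_div hθ

/-- The quadratic integrand of the weak Euler form of the limit, in coordinates:
`⟪v, DΦ[v]⟫ = Σᵢⱼ vᵢ vⱼ ∂ⱼΦᵢ`. [folklore] -/
theorem inner_vel_convect_eq {Φ : UnitAddTorus d → Ed d} (hΦ : Torus.IsSmooth Φ) (x : UnitAddTorus d) :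
    ⟪vel (D.wlim x), Torus.convect (fun y => vel (D.wlim y)) Φ x⟫_ℝ =
      ∑ i, ∑ j, vel (D.wlim x) i * vel (D.wlim x) j * Torus.partialDeriv j (fun y => Φ y i) x := by
  rw [Torus.convect, PiLp.inner_apply]
  refine Finset.sum_congr rfl fun i _ => ?_
  simp only [RCLike.inner_apply, conj_trivial, fderiv_apply_apply hΦ, Finset.sum_mul]
  refine Finset.sum_congr rfl fun j _ => ?_
  ring

/-- Almost everywhere, the quadratic integrand is the stress observable `Σᵢⱼ uᵢⱼ ∂ⱼΦᵢ` of the limit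
(`u = v ⊗ v - e/d Id` a.e. and `div Φ = 0`). [cite: ChoffrutSzekelyhidi2014, Lemma 2] -/
theorem inner_vel_convect_ae_eq {Φ : UnitAddTorus d → Ed d} (hΦ : Torus.IsSmooth Φ) (hdiv : Torus.IsDivFree Φ) :
    (fun x => ⟪vel (D.wlim x), Torus.convect (fun y => vel (D.wlim y)) Φ x⟫_ℝ) =ᵐ[volume]
      fun x => ∑ i, ∑ j, str (D.wlim x) i j * Torus.partialDeriv j (fun y => Φ y i) x := by
  filter_upwards [D.ae_wlim_mem_K] with x hx
  rw [D.inner_vel_convect_eq hΦ]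
  have hstr : ∀ i j, str (D.wlim x) i j =
      vel (D.wlim x) i * vel (D.wlim x) j - if i = j then D.e x / Fintype.card d else 0 := by
    intro i j
    rw [hx.2, Matrix.sub_apply, Matrix.smul_apply, Matrix.one_apply]
    simp [tensorSelf, Matrix.vecMulVec_apply]
  have hdivx : ∑ i, Torus.partialDeriv i (fun y => Φ y i) x = 0 := hdiv x
  simp_rw [hstr, sub_mul, Finset.sum_sub_distrib]
  have htr : ∑ i, ∑ j, (if i = j then D.e x / Fintype.card d else 0) * Torus.partialDeriv j (fun y => Φ y i) x = 0 := by
    simp_rw [ite_mul, zero_mul, Finset.sum_ite_eq, Finset.mem_univ, if_true, ← Finset.mul_sum, hdivx, mul_zero]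
  rw [htr, sub_zero]

/-- The quadratic integrand of the weak Euler form of the limit is integrable. [folklore] -/
theorem integrable_inner_vel_convect {Φ : UnitAddTorus d → Ed d} (hΦ : Torus.IsSmooth Φ) (hdiv : Torus.IsDivFree Φ) :
    Integrable (fun x => ⟪vel (D.wlim x), Torus.convect (fun y => vel (D.wlim y)) Φ x⟫_ℝ) volume := by
  refine Integrable.congr ?_ (D.inner_vel_convect_ae_eq hΦ hdiv).symm
  refine integrable_finsetSum _ fun i _ => integrable_finsetSum _ fun j _ => ?_
  simpa only [str_apply] using
    D.integrable_wlim_coord_mul (Sum.inr (i, j)) ((hΦ.apply i).partialDeriv j).continuous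

/-- **The weak Euler form of the limit velocity is the stress identity of the base field**:
`∫ ⟪v, (v·∇)Φ⟫ = ∫ Σᵢⱼ (u₀)ᵢⱼ ∂ⱼΦᵢ` for smooth divergence-free `Φ`. [cite: ChoffrutSzekelyhidi2014, Lemma 2] -/
theorem integral_inner_vel_wlim_convect {Φ : UnitAddTorus d → Ed d} (hΦ : Torus.IsSmooth Φ) (hdiv : Torus.IsDivFree Φ) :
    ∫ x, ⟪vel (D.wlim x), Torus.convect (fun y => vel (D.wlim y)) Φ x⟫_ℝ =
      ∫ x, ∑ i, ∑ j, str (D.w₀ x) i j * Torus.partialDeriv j (fun y => Φ y i) x := by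
  rw [integral_congr_ae (D.inner_vel_convect_ae_eq hΦ hdiv)]
  exact D.wlim_weak_str hΦ hdiv

/-- **The power bound**: with the test field `t = (g, 0)`, `∫ ⟪v, g⟫ ≥ ∫ ⟪v₀, g⟫ - θ`. [folklore] -/
theorem le_integral_inner_vel_wlim {g : UnitAddTorus d → Ed d} (ht : D.t = ForcedFlows.velState g) :
    (∫ x, ⟪vel (D.w₀ x), g x⟫_ℝ) - D.θ ≤ ∫ x, ⟪vel (D.wlim x), g x⟫_ℝ := by
  have h := D.le_integral_inner_wlim_t
  simp only [ht, ForcedFlows.inner_velState] at h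
  exact h

end FIterData

/-! ## The witness on `T³` -/

/-- The Kolmogorov-type shear force `f(x) = sin(2π x₁) e₀` on `T³`. [folklore] -/
def force (x : UnitAddTorus (Fin 3)) : Ed (Fin 3) := Torus.sinCoord 1 x • EuclideanSpace.single 0 1

/-- Coordinates of the force: `f₀ = sin(2π x₁)`, `f₁ = f₂ = 0`. [folklore] -/
theorem force_apply (x : UnitAddTorus (Fin 3)) (i : Fin 3) :
    force x i = if i = 0 then Torus.sinCoord 1 x else 0 := by
  simp only [force, PiLp.smul_apply, PiLp.single_apply, smul_eq_mul, mul_ite, mul_one, mul_zero]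

/-- The force is smooth. [folklore] -/
theorem isSmooth_force : Torus.IsSmooth force :=
  (Torus.isSmooth_sinCoord 1).smul' (Torus.isSmooth_const _)

/-- The force is divergence free (`∂₀ sin(2π x₁) = 0`). [folklore] -/
theorem isDivFree_force : Torus.IsDivFree force := by
  intro x
  rw [Torus.divergence]
  refine Finset.sum_eq_zero fun i _ => ?_
  by_cases hi : i = 0
  · subst hi
    have h : (fun y => force y 0) = Torus.sinCoord 1 := funext fun y => by simp [force_apply]
    rw [h, Torus.partialDeriv_sinCoord]
    simp
  · have h : (fun y => force y i) = fun _ => (0 : ℝ) := funext fun y => by simp [force_apply, hi]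
    rw [h]
    exact Torus.partialDeriv_const_apply _ _ _

/-- `∫ sin(2π x₁) dx = 0` on `T³` (`sin(2π x₁) = -(2π)⁻¹ ∂₁ cos(2π x₁)` and `∫ ∂₁ = 0`). [folklore] -/
theorem integral_sinCoord_one : ∫ x : UnitAddTorus (Fin 3), Torus.sinCoord 1 x = 0 := by
  have h : (fun x : UnitAddTorus (Fin 3) => Torus.sinCoord 1 x) =
      fun x => (-(2 * Real.pi))⁻¹ * Torus.partialDeriv 1 (Torus.cosCoord 1) x := by
    funext x
    rw [Torus.partialDeriv_cosCoord]
    simp only [if_true]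
    have hπ : (2 : ℝ) * Real.pi ≠ 0 := by positivity
    field_simp
  rw [h, integral_const_mul, Torus.integral_partialDeriv_eq_zero_holds (F := ℝ) (Torus.isSmooth_cosCoord 1) 1, mul_zero]

/-- The force has zero mean. [folklore] -/
theorem hasZeroMean_force : Torus.HasZeroMean force := by
  show ∫ x, force x = 0
  simp only [force]
  rw [integral_smul_const, integral_sinCoord_one, zero_smul]

/-- **The force has positive energy**: `∫ ⟪f, f⟫ > 0` (`f(x) = e₀` at `x₁ = 1/4`). [folklore] -/
theorem integral_inner_force_pos : 0 < ∫ x, ⟪force x, force x⟫_ℝ := by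
  haveI : (volume : Measure (UnitAddTorus (Fin 3))).IsOpenPosMeasure := by
    rw [volume_pi]; infer_instance
  set x₀ : UnitAddTorus (Fin 3) := fun _ => (((1 / 4 : ℝ)) : UnitAddCircle) with hx₀
  have hs : Torus.sinCoord 1 x₀ = 1 := by
    rw [Torus.sinCoord_of_eq (show x₀ 1 = (((1 / 4 : ℝ)) : UnitAddCircle) from rfl)]
    rw [show 2 * Real.pi * (1 / 4) = Real.pi / 2 by ring, Real.sin_pi_div_two]
  refine integral_pos_of_integrable_nonneg_nonzero (x := x₀) (isSmooth_force.continuous.inner isSmooth_force.continuous)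
    ((isSmooth_force.continuous.inner isSmooth_force.continuous).integrable_unitAddTorus) (fun x => real_inner_self_nonneg) ?_
  rw [real_inner_self_eq_norm_sq]
  have hf : force x₀ = EuclideanSpace.single 0 1 := by rw [force, hs, one_smul]
  rw [hf]
  simp

/-! ## The forced run and the item -/

end StandingCascade

open StandingCascade in
/-- **`StandingCascadeExists`** (item stmt-AnomalousDissipation-1309): a smooth divergence-free
mean-zero force `f` on `T³` and a bounded weakly divergence-free weak stationary Euler flow `v`
driven by `f` with `∫ ⟪f, v⟫ > 0`, by the forced Choffrut–Székelyhidi iteration started at the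
affine subsolution `(f, ℛf)`. [cite: ChoffrutSzekelyhidi2014, Thm. 1, §2] -/
theorem standingCascadeExists_proof :
    Summit.AnomalousDissipation.AnomalousDissipation.Theses.SteadyWeakLimit.StandingCascadeExists := by
  unfold Summit.AnomalousDissipation.AnomalousDissipation.Theses.SteadyWeakLimit.StandingCascadeExists
  -- the base field, its strictness level and the run
  have hf := isSmooth_force
  have hw₀ : Torus.IsSmooth (ForcedFlows.forcedState force) := ForcedFlows.isSmooth_forcedState hf
  obtain ⟨E, -, hE⟩ := ForcedFlows.exists_forall_mem_highDimU hw₀.continuous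
    (ForcedFlows.isAdm_forcedState (by simp) hf)
  set P : ℝ := ∫ x, ⟪force x, force x⟫_ℝ with hP
  have hP0 : 0 < P := integral_inner_force_pos
  set D : FIterData (Fin 3) := ⟨HighDim.relaxedFamily (by simp), fun _ => E, ForcedFlows.forcedState force,
    ForcedFlows.velState force, P / 2, continuous_const, hw₀, hE, (ForcedFlows.isSmooth_velState hf).continuous,
    half_pos hP0⟩ with hD
  set v : UnitAddTorus (Fin 3) → Ed (Fin 3) := fun x => vel (D.wlim x) with hv
  refine ⟨force, hf, isDivFree_force, hasZeroMean_force, v, D.memLp_vel_wlim, fun θ hθ => ?_, fun w hw hwdiv => ?_, ?_⟩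
  · -- weakly divergence free: `∫ ⟪v, ∇θ⟫ = ∫ ⟪f, ∇θ⟫ = -∫ θ div f = 0`
    rw [D.integral_inner_vel_wlim_gradient hθ]
    have h1 : ∀ x, ∑ i, vel (D.w₀ x) i * Torus.partialDeriv i θ x = ⟪force x, Torus.gradient θ x⟫_ℝ := fun x => by
      rw [real_inner_comm, Torus.inner_gradient_left, Torus.fderiv_apply_eq_sum_partialDeriv (hθ.isContDiff (by simp))]
      simp only [smul_eq_mul, hD, ForcedFlows.vel_forcedState]
    simp_rw [h1]
    rw [Torus.integral_inner_gradient_eq_neg_integral_mul_divergence_holds hf hθ]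
    simp [isDivFree_force _]
  · -- the forced weak Euler identity
    have hA := D.integrable_inner_vel_convect hw hwdiv
    have hB : Integrable (fun x => ⟪force x, w x⟫_ℝ) volume := (isSmooth_force.continuous.inner hw.continuous).integrable_unitAddTorus
    rw [integral_add hA hB, D.integral_inner_vel_wlim_convect hw hwdiv]
    have hstr : ∫ x, ∑ i, ∑ j, str (D.w₀ x) i j * Torus.partialDeriv j (fun y => w y i) x =
        -∫ x, ∑ i, (force x i - (∫ y, force y) i) * w x i := by
      simpa only [hD] using ForcedFlows.integral_str_forcedState (by simp) hf hw
    have hmean : (∫ y, force y) = 0 := hasZeroMean_force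
    have hfw : ∀ x, ∑ i, (force x i - (∫ y, force y) i) * w x i = ⟪force x, w x⟫_ℝ := fun x => by
      simp only [hmean, PiLp.zero_apply, sub_zero, PiLp.inner_apply, RCLike.inner_apply, conj_trivial]
      exact Finset.sum_congr rfl fun i _ => mul_comm _ _
    simp_rw [hfw] at hstr
    rw [hstr]
    ring
  · -- positive power: `∫ ⟪f, v⟫ ≥ ∫ ⟪f, f⟫ - P/2 = P/2 > 0`
    have h := D.le_integral_inner_vel_wlim (g := force) rfl
    have h0 : ∫ x, ⟪vel (D.w₀ x), force x⟫_ℝ = P := by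
      simp only [hD, ForcedFlows.vel_forcedState, hP]
    have hθ : D.θ = P / 2 := rfl
    rw [h0, hθ] at h
    have hcomm : ∫ x, ⟪force x, v x⟫_ℝ = ∫ x, ⟪vel (D.wlim x), force x⟫_ℝ :=
      integral_congr_ae (Eventually.of_forall fun x => real_inner_comm _ _)
    rw [hcomm]
    linarith

end Summit.AnomalousDissipation.AnomalousDissipation.Theorems
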